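import Mathlib.Algebra.BigOperators.Finprod
import Mathlib.Algebra.Group.Int.Units
import Mathlib.Algebra.Ring.Parity
import Mathlib.Data.Set.Finite.Basic
import HarnessLib

/-!
# Kottwitz 1983: the sign `e(G)` of a connected reductive group (typed skeleton)

R. E. Kottwitz, *Sign changes in harmonic analysis on reductive groups*, Trans. Amer. Math. Soc. 278 (1983) 289–297
[Kottwitz1983] (held text `paper:doi-10-1090-s0002-9947-1983-0697075-6`, 9 files, pdf p000N = printed p. 288+N; quotations AS
PRINTED, read on p0001–p0009).  Carpet file of squad TK (cell `pub/hodgecm-mathlib`, seat TK-t08): STATEMENTS ONLY — no proof, no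
`sorry`, no axiom, no instance, no notation.  TYPED SKELETON (style of `Literature/NumberTheory/Rogawski1990/GlobalPackets.lean` and
`Literature/AlgebraicGeometry/Liu2021/AlbaneseUnitaryShimura.lean`): hypothesis structures of BARE CARRIERS naming the objects the
printed statements quantify over (connected reductive groups over a LOCAL field `F` and over its finite extensions, with the sign
`e(·) ∈ {±1}`, quasi-split inner forms, products, central quotients, centralizers of split tori, base change, restriction of
scalars, the invariants `q` and `r`, central simple algebras; the places of a global field with the local signs `e(G_v)`), and
predicates `def P (D : …Datum) : Prop` for the Corollary (p. 295), the evaluation of `e(G)` over `ℂ`, `ℝ` and nonarchimedean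
fields (pp. 289–290, 295–297) and the product formula (p. 297).  NOTHING IS ASSERTED (a consumer takes `(h : D.P)`).

DEDUP.  The tree already READS `e(G)` in the one case the cell uses — the centralizers `G_{γ′}` of split-singular semisimple
elements of a unitary group in three variables: `Literature.NumberTheory.Rogawski1990.kottwitzSign` (`KottwitzSign.lean`: `−1` iff
the eigenplane is anisotropic ∕ definite, i.e. `(−1)^{q(G_{γ′}) − q(G_{γ′}^{qs})}` resp. `(−1)^{r − r'}` computed, with
`kottwitzSign_eq_neg_one_iff`, …), its place-by-place readings (`KottwitzSignReadings.lean`, `KottwitzSignPlaceReadings.lean`,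
`KottwitzSignLocalFlip.lean`, …) and the product formula in that setting, PROVED
(`KottwitzSignProductFormula.lean`: `kottwitzSignAdelic_toAdelic_eq_one`).  Those are the `U(3)` special cases of `EReal`,
`ENonarch` and `ProductFormula` below; they are cited, not restated.  No general notion of connected reductive group, inner
form, `F`-rank or Galois∕flat cohomology exists in Mathlib or the tree, whence the carriers.

THE PRINT.  (Abstract, p. 289, p0001 L9–L14) «Let `G` be a connected reductive group over a field `F`. In this note the author
constructs an element `e(G)` of the Brauer group of `F`. The square of this element is trivial. For a local field, `e(G)` may be
regarded as an element of `{±1}` and is needed for harmonic analysis on reductive groups over that field. For a global field there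
is a product formula.»  (p. 289, p0001 L21–L27, L33–L35) «The sign change in the character identity is `(−1)^{q(G′)−q(G)}` where
`q(G)` is one half of the dimension of the symmetric space attached to `G` (more precisely, attached to the simply connected cover
of the derived group of `G`). Although `q(G)` may be only half integral, the difference `q(G′) − q(G)` is always integral. […] Let
`r(G)` denote the `F`-rank of the derived group of `G`».  (pp. 289–290, p0001 L40–L42, p0002 L5–L9) «Later in this paper we will
use a cohomological construction to define a sign `e(G) = ±1` for any connected reductive group `G` over a local field. Let `G′`
denote a quasi-split inner form of `G`. We will show that `e(G) = (−1)^{r(G′)−r(G)}` when the base field is nonarchimedean,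
`e(G) = (−1)^{q(G′)−q(G)}` when the base field is `ℝ`, and `e(G) = 1` when the base field is `ℂ`. For a group `G` over a global
field we will prove a product formula `∏_v e(G_v) = 1`; the product is taken over all places `v` of the global field, all but a
finite number of terms in the product being `1`.»  (Construction, pp. 291–292, p0003 L11–L17, p0004 L13–L15: «For any field `F`
denote by `B₂(F)` the subgroup of the Brauer group of `F` consisting of elements `x` such that `2x = 0`. For any connected
reductive group `G` over `F`, we will define an element `e(G)` of `B₂(F)`. […] Applying the maps (1), (2), (3)
[`H¹(F, G′_ad) → H¹_fl(F, G′_ad) → H²_fl(F, Z) → H²_fl(F, 𝔾_m) = Br(F)`, `λ = ρ|_Z`] to the element of `H¹(F, G′_ad)` obtained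
from the inner twisting `ψ`, we get an element `e(G)` of `B₂(F)`.»)  (Proposition, pp. 292–293, p0004 L42–L52, p0005 L3–L12)
«Proposition. The following properties are satisfied by `e(G)`. (1) If `G` is quasi-split, then `e(G) = 1`. (2) For any central
subgroup `Z` of `G` we have `e(G) = e(G/Z)`. (3) `e(G₁ × G₂) = e(G₁)e(G₂)` (using multiplicative notation in the Brauer group).
(4) Let `E` be an extension field of `F`. Then for any `G` over `F` we have `e(G_E) = Res_{E/F}(e(G))` […]. (5) Let `E` be a
finite separable extension field of `F`. Then for any `G` over `E` we have `e(R(G)) = Cor_{E/F}(e(G))` where `R(G)` denotes the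
`F`-group obtained from `G` by restriction of scalars from `E` to `F` […]. (6) Let `S` be an `F`-split torus of `G` and let `M`
be the centralizer of `S` in `G`. Then `e(G) = e(M)`. (7) Let `D` be a central simple algebra over `F` of dimension `d²` and let
`G` be the `F`-group `D^×`. Let `[D]` denote the class of `D` in the Brauer group of `F`. If `d` is odd, then `e(G)` is trivial.
If `d` is even, then `e(G) = [D]^{d/2}`.»  (Corollary, p. 295, p0007 L20–L36) «Corollary. Over a local field `F` the following
properties are satisfied by `e(G)`, with `e(G)` now viewed as an element of `{±1}`. (1) If `G` is quasi-split, then `e(G) = 1`.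
(2) For any central subgroup `Z` of `G` we have `e(G) = e(G/Z)`. (3) `e(G₁ × G₂) = e(G₁)e(G₂)`. (4) Let `E` be a finite extension
field of `F`. Then for any `G` over `F` we have `e(G_E) = e(G)^{[E:F]}`. (5) Let `E` be a finite separable extension field of `F`.
Then for any `G` over `E` we have `e(Res_{E/F} G) = e(G)`. (6) Let `S` be an `F`-split torus of `G` and let `M = Cent_G(S)`. Then
`e(G) = e(M)`. (7) Let `D` be a central simple algebra over `F` of dimension `d²` with invariant `r/d ∈ ℚ/ℤ` and let `G` be the
`F`-group `D^×`. Then `e(G)` is trivial unless `d` is even and `r` is odd, in which case `e(G) = −1`.»  (p. 295, p0007 L38–L43;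
p. 296, p0008 L40–L43) «We are now in a position to show that `e(G)` has the values given previously. For `F = ℂ` the Brauer group
is trivial and hence `e(G) = 1` for all `G`. For `F = ℝ` we define a quantity `e′(G)` by the formula `e′(G) = (−1)^{q(G′)−q(G)}`. We
must prove that `e(G) = e′(G)` for all `G`. […] We will use a similar method for nonarchimedean local fields `F`. In this case we
define a quantity `e′(G)` by the formula [`e′(G) = (−1)^{r(G′)−r(G)}`]. We must show that `e(G) = e′(G)` for all `G`.»
(Product formula, p. 297, p0009 L12–L20) «Proposition. Let `F` be a global field and let `S` be the set of places of `F`. For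
`v ∈ S` let `G_v` denote the `F_v`-group obtained from `G` by extension of scalars from `F` to `F_v`. Then `e(G_v) = 1` for all but
a finite number of `v ∈ S`, and `∏_{v∈S} e(G_v) = 1`.»

NOT typed here: the cohomological construction itself (needs nonabelian Galois ∕ flat cohomology of reductive groups, absent from
Mathlib and the tree) and the Brauer-group-valued Proposition (4), (5), (7) over an arbitrary field (Mathlib's `BrauerGroup F` is a
bare quotient type without its group law, `Res`, `Cor`); the Proposition's (1), (2), (3), (6) have the shape of the Corollary's and
are covered by it over local fields; the two motivating examples of pp. 289–290 (base change for `GL₂`, quaternion algebras).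
HC_CM is proved only modulo the printed citations until rung 0 closes; this file discharges none of them.

## References
* [Kottwitz1983] R. E. Kottwitz, *Sign changes in harmonic analysis on reductive groups*, Trans. Amer. Math. Soc. 278 (1983)
  289–297: Abstract and introduction pp. 289–291, construction pp. 291–292, Proposition pp. 292–293, Corollary p. 295, values of
  `e(G)` pp. 295–297, product formula (Proposition) p. 297.
* [Rogawski1990] J. D. Rogawski, *Automorphic Representations of Unitary Groups in Three Variables*, §4.1 (4.1.2) p. 39 (the use
  of `e(γ′)`; tree: `Literature/NumberTheory/Rogawski1990/KottwitzSign*.lean`).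
-/

namespace Literature.NumberTheory.Kottwitz1983.SignChanges

universe u

/-! ## Local fields: the Corollary (p. 295) and the values of `e(G)` (pp. 295–297) -/

/-- **Carriers over a LOCAL field `F`** [Kottwitz1983, pp. 289–297].  Fields:
* `IsNonarch`, `IsReal`, `IsComplex` — the kind of the local field `F`;
* `Grp` — connected reductive groups over `F` (up to isomorphism); `e G ∈ ℤˣ = {±1}` — the sign «`e(G)` now viewed as an element of
  `{±1}`» (p. 295); `IsQuasiSplit G`; `qsInnerForm G = G′`, «a quasi-split inner form of `G`» (p. 289);
* `prod G₁ G₂ = G₁ × G₂`; `CentralSub G` — the central subgroups `Z` of `G`, `quot G Z = G/Z`; `SplitTorus G` — the `F`-split tori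
  `S` of `G`, `centralizer G S = Cent_G(S)`;
* `Ext` — the finite extension fields `E` of `F`, `degree E = [E : F]`, `IsSeparable E`; `GrpOver E` — connected reductive groups over
  `E`, `eOver E G = e(G)` for those; `baseChange E G = G_E`; `weilRestrict E G = Res_{E/F} G`;
* `twoQ G = 2q(G)` — the dimension of the symmetric space attached to (the simply connected cover of the derived group of) `G`
  (`F = ℝ`, p. 289); `derivedRank G = r(G)` — the `F`-rank of the derived group of `G` (p. 289);
* `CSA` — central simple algebras `D` over `F`, `csaDegree D = d` (`dim_F D = d²`), `csaInvNumerator D = r` with `inv(D) = r/d ∈ ℚ/ℤ`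
  (p. 295), `unitGroup D = D^×` as an `F`-group.
[cite: Kottwitz1983, pp. 289–290, 295–297] -/
structure LocalSignDatum where
  /-- `F` is nonarchimedean -/
  IsNonarch : Prop
  /-- `F ≅ ℝ` -/
  IsReal : Prop
  /-- `F ≅ ℂ` -/
  IsComplex : Prop
  /-- connected reductive `F`-groups -/
  Grp : Type u
  /-- the Kottwitz sign `e(G) ∈ {±1}` -/
  e : Grp → ℤˣ
  /-- `G` is quasi-split over `F` -/
  IsQuasiSplit : Grp → Prop
  /-- the quasi-split inner form `G′` -/
  qsInnerForm : Grp → Grp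
  /-- `G₁ × G₂` -/
  prod : Grp → Grp → Grp
  /-- central subgroups `Z ⊆ G` -/
  CentralSub : Grp → Type u
  /-- `G/Z` -/
  quot : (G : Grp) → CentralSub G → Grp
  /-- `F`-split tori `S ⊆ G` -/
  SplitTorus : Grp → Type u
  /-- `Cent_G(S)` -/
  centralizer : (G : Grp) → SplitTorus G → Grp
  /-- finite extensions `E/F` -/
  Ext : Type u
  /-- `[E : F]` -/
  degree : Ext → ℕ
  /-- `E/F` separable -/
  IsSeparable : Ext → Prop
  /-- connected reductive `E`-groups -/
  GrpOver : Ext → Type u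
  /-- `e(G)` for `G` over `E` -/
  eOver : (E : Ext) → GrpOver E → ℤˣ
  /-- `G ↦ G_E` -/
  baseChange : (E : Ext) → Grp → GrpOver E
  /-- `G ↦ Res_{E/F} G` -/
  weilRestrict : (E : Ext) → GrpOver E → Grp
  /-- `2q(G)`, the dimension of the symmetric space (`F = ℝ`) -/
  twoQ : Grp → ℕ
  /-- `r(G)`, the `F`-rank of `G_der` -/
  derivedRank : Grp → ℕ
  /-- central simple algebras over `F` -/
  CSA : Type u
  /-- `d`, `dim_F D = d²` -/
  csaDegree : CSA → ℕ
  /-- `r`, `inv(D) = r/d` -/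
  csaInvNumerator : CSA → ℕ
  /-- `D^×` as an `F`-group -/
  unitGroup : CSA → Grp

namespace LocalSignDatum

/-- **[Kottwitz1983, Corollary (1), p. 295]**: «If `G` is quasi-split, then `e(G) = 1`.»  Nothing is asserted.
[cite: Kottwitz1983, Corollary (1) (p. 295)] -/
def Cor1 (D : LocalSignDatum.{u}) : Prop :=
  ∀ G : D.Grp, D.IsQuasiSplit G → D.e G = 1

/-- **[Kottwitz1983, Corollary (2), p. 295]**: «For any central subgroup `Z` of `G` we have `e(G) = e(G/Z)`.»  Nothing is asserted.
[cite: Kottwitz1983, Corollary (2) (p. 295)] -/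
def Cor2 (D : LocalSignDatum.{u}) : Prop :=
  ∀ (G : D.Grp) (Z : D.CentralSub G), D.e G = D.e (D.quot G Z)

/-- **[Kottwitz1983, Corollary (3), p. 295]**: «`e(G₁ × G₂) = e(G₁)e(G₂)`.»  Nothing is asserted.
[cite: Kottwitz1983, Corollary (3) (p. 295)] -/
def Cor3 (D : LocalSignDatum.{u}) : Prop :=
  ∀ G₁ G₂ : D.Grp, D.e (D.prod G₁ G₂) = D.e G₁ * D.e G₂

/-- **[Kottwitz1983, Corollary (4), p. 295]**: «Let `E` be a finite extension field of `F`. Then for any `G` over `F` we have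
`e(G_E) = e(G)^{[E:F]}`.»  Nothing is asserted. [cite: Kottwitz1983, Corollary (4) (p. 295)] -/
def Cor4 (D : LocalSignDatum.{u}) : Prop :=
  ∀ (E : D.Ext) (G : D.Grp), D.eOver E (D.baseChange E G) = D.e G ^ D.degree E

/-- **[Kottwitz1983, Corollary (5), p. 295]**: «Let `E` be a finite separable extension field of `F`. Then for any `G` over `E` we
have `e(Res_{E/F} G) = e(G)`.»  Nothing is asserted. [cite: Kottwitz1983, Corollary (5) (p. 295)] -/
def Cor5 (D : LocalSignDatum.{u}) : Prop :=
  ∀ (E : D.Ext), D.IsSeparable E → ∀ G : D.GrpOver E, D.e (D.weilRestrict E G) = D.eOver E G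

/-- **[Kottwitz1983, Corollary (6), p. 295]**: «Let `S` be an `F`-split torus of `G` and let `M = Cent_G(S)`. Then `e(G) = e(M)`.»
Nothing is asserted. [cite: Kottwitz1983, Corollary (6) (p. 295)] -/
def Cor6 (D : LocalSignDatum.{u}) : Prop :=
  ∀ (G : D.Grp) (S : D.SplitTorus G), D.e G = D.e (D.centralizer G S)

/-- **[Kottwitz1983, Corollary (7), p. 295]**: «Let `D` be a central simple algebra over `F` of dimension `d²` with invariant
`r/d ∈ ℚ/ℤ` and let `G` be the `F`-group `D^×`. Then `e(G)` is trivial unless `d` is even and `r` is odd, in which case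
`e(G) = −1`.»  TYPED (`ℤˣ = {±1}`): `e(D^×) = −1` iff `d` is even and `r` is odd.  Nothing is asserted.
[cite: Kottwitz1983, Corollary (7) (p. 295)] -/
def Cor7 (D : LocalSignDatum.{u}) : Prop :=
  ∀ A : D.CSA, D.e (D.unitGroup A) = -1 ↔ Even (D.csaDegree A) ∧ Odd (D.csaInvNumerator A)

/-- **`e(G) = 1` over `ℂ`** (p. 290: «`e(G) = 1` when the base field is `ℂ`»; p. 295: «For `F = ℂ` the Brauer group is trivial and
hence `e(G) = 1` for all `G`»).  Nothing is asserted. [cite: Kottwitz1983, p. 295 (and p. 290)] -/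
def EComplex (D : LocalSignDatum.{u}) : Prop :=
  D.IsComplex → ∀ G : D.Grp, D.e G = 1

/-- **`e(G) = (−1)^{q(G′) − q(G)}` over `ℝ`** (p. 290; proved pp. 295–296: «For `F = ℝ` we define a quantity `e′(G)` by the formula
`e′(G) = (−1)^{q(G′)−q(G)}`. We must prove that `e(G) = e′(G)` for all `G`»), `G′` the quasi-split inner form, `q` one half of
the dimension of the symmetric space, and (p. 289) «Although `q(G)` may be only half integral, the difference `q(G′) − q(G)` is
always integral».  TYPED with `twoQ = 2q`: the integer `2q(G′) − 2q(G)` is even and `e(G) = (−1)^{(2q(G′) − 2q(G))/2}`.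
Nothing is asserted. [cite: Kottwitz1983, pp. 295–296 (and pp. 289–290)] -/
def EReal (D : LocalSignDatum.{u}) : Prop :=
  D.IsReal → ∀ G : D.Grp,
    Even ((D.twoQ (D.qsInnerForm G) : ℤ) - D.twoQ G) ∧
      D.e G = (-1 : ℤˣ) ^ (((D.twoQ (D.qsInnerForm G) : ℤ) - D.twoQ G) / 2)

/-- **`e(G) = (−1)^{r(G′) − r(G)}` over a nonarchimedean local field** (p. 290; proved pp. 296–297: «We will use a similar method
for nonarchimedean local fields `F`. In this case we define a quantity `e′(G)` by the formula [`e′(G) = (−1)^{r(G′)−r(G)}`]. We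
must show that `e(G) = e′(G)` for all `G`»), `r(G)` the `F`-rank of the derived group, `G′` the quasi-split inner form.
Nothing is asserted. [cite: Kottwitz1983, pp. 296–297 (and p. 290)] -/
def ENonarch (D : LocalSignDatum.{u}) : Prop :=
  D.IsNonarch → ∀ G : D.Grp,
    D.e G = (-1 : ℤˣ) ^ ((D.derivedRank (D.qsInnerForm G) : ℤ) - D.derivedRank G)

end LocalSignDatum

/-! ## Global fields: the product formula (p. 297) -/

/-- **Carriers for the product formula**: a connected reductive group `G` over a global field `F` is posited through the set
`Place` of places `v` of `F` and the local signs `eAt v = e(G_v) ∈ {±1}` of the `F_v`-groups `G_v = G ×_F F_v` (p. 297).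
[cite: Kottwitz1983, Proposition (p. 297)] -/
structure GlobalSignDatum where
  /-- the places `v` of `F` -/
  Place : Type u
  /-- `e(G_v)` -/
  eAt : Place → ℤˣ

namespace GlobalSignDatum

/-- **[Kottwitz1983, Proposition, p. 297] — the product formula**, AS PRINTED: «Let `F` be a global field and let `S` be the set of
places of `F`. For `v ∈ S` let `G_v` denote the `F_v`-group obtained from `G` by extension of scalars from `F` to `F_v`. Then
`e(G_v) = 1` for all but a finite number of `v ∈ S`, and `∏_{v∈S} e(G_v) = 1`.»  (The tree proves the `U(3)`-with-CM instance:
`Literature.NumberTheory.Rogawski1990.kottwitzSignAdelic_toAdelic_eq_one`.)  Nothing is asserted.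
[cite: Kottwitz1983, Proposition (p. 297)] -/
def ProductFormula (D : GlobalSignDatum.{u}) : Prop :=
  {v : D.Place | D.eAt v ≠ 1}.Finite ∧ ∏ᶠ v : D.Place, D.eAt v = 1

end GlobalSignDatum

end Literature.NumberTheory.Kottwitz1983.SignChanges
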